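import Literature.NumberTheory.Automorphic.Liu2021.CheckOfChi
import Literature.NumberTheory.Automorphic.ClassFieldCharacter
import Literature.NumberTheory.Automorphic.ConjugateSelfDualCharacters
import Literature.NumberTheory.Automorphic.IdeleClassCharacterHecke
import Literature.NumberTheory.Automorphic.RelNormOneTorus
import Literature.NumberTheory.GaloisRepresentations.CMTypeHeckeCharacter
import HarnessLib

/-!
# `χ̌ᶜ = χ̌⁻¹`, `χ̌|_{𝕀_F} = 1`, and the relabel `μ ↦ μ·χ̌` keeps «conjugate-symplectic of the same ∞-type»

[Liu2021, App. D §D.1 (l. 5224)]: `χ̌(x) = χ(x/xᶜ)` for an automorphic character `χ` of `E¹\(𝔸_E^∞)¹`; [Liu2021, Lemma D.1 (4)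
(l. 5235)]: the relabel `μ′ = μᶜχ̌` (rank 2); [Liu2021, Def. 4.1 (l. 1900–1902)]: conjugate self-dual / orthogonal / symplectic
characters.  Sequel of ★ `CheckOfChi` (`HeckeCharacter.checkOfChi hcc χ`).  THEOREMS ONLY: no definition, no named fact, no
instance, no `sorry`; count-neutral.

* §1 (generic quadratic `E/F`, `c`, `hcc : c * c = 1`): `idelicFinPart_smul` (`(c • x)_f = c • x_f`), `finAdelicCheck_unitsMap_conj`
  (`(c u)/(c u)ᶜ = (u/uᶜ)⁻¹`), **`checkOfChi_smul : χ̌ (c • x) = (χ̌ x)⁻¹`**, **`galConj_checkOfChi : galConj c χ̌ = χ̌⁻¹`**;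
  `checkOfChi_eq_one_of_smul_eq` (`c • x = x ⇒ χ̌ x = 1`), **`checkOfChi_ideleBaseChange : χ̌ (x_E) = 1`** for idèles `x` of `F`
  (`χ̌|_{𝕀_F} = 1`, the conjugate-ORTHOGONAL clause); local forms `localComponent_checkOfChi_smul`
  (`χ̌_{c•w}(c_* u) = χ̌_w(u)⁻¹`, no ramification hypothesis), `isUnramifiedAt_checkOfChi_smul_iff`, `valueAtUniformizer_checkOfChi_inv`,
  `valueAtUniformizer_checkOfChi_smul` (`χ̌(ϖ_{c•w}) = χ̌(ϖ_w)⁻¹` off `cond(χ̌)`).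
* §2 (CM field `L`, `L⁺ = maximalRealSubfield L`, `c = complexConj`): for unitary idele class characters `μ μ′` of `L` with
  `h : toHeckeCharacter L μ′ = toHeckeCharacter L μ * checkOfChi hcc χ` (the relabel `μ′ = μ·χ̌`, stated as a HYPOTHESIS — constructing
  `μ′` as a `→ₜ* Circle` is a one-line definition left to a DEF-lane file): `μ′` and `μ` agree on `classBaseChange L⁺ L`, on the classes
  of the infinite idèles, and on the Galois norms `[y ȳ]`; hence **`IsConjugateSymplectic L μ′ ↔ IsConjugateSymplectic L μ`**, the same for
  `IsConjugateOrthogonal`, `IsConjugateSelfDual`, `HasInfinityType L · e`, `HasWeight L · 𝔴`, `HasCMType L · Φ` — the bookkeeping behind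
  «`μ·χ̌` is again conjugate-symplectic of weight one with the same CM type» (the relabel road of [Liu2021, Lem. D.1 (4) / Thm. D.6]).

HC_CM is NOT proved by anything here.

## References
* [Liu2021] Y. Liu, *Fourier–Jacobi cycles and arithmetic relative trace formula*, Camb. J. Math. 9 (2021) = arXiv:2102.11518,
  Def. 4.1 (l. 1900–1902), Def. 4.3; App. D §D.1 (l. 5224); Lemma D.1 (4) (l. 5235); Thm. D.6 (l. 5441).
* [CasselsFrohlichANT1967] Cassels–Fröhlich, *Algebraic Number Theory* (1967), Ch. VII §1.1 (Galois action on idèles).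
-/

set_option autoImplicit false

noncomputable section

open NumberField IsDedekindDomain

namespace Literature.NumberTheory.Automorphic.Liu2021.CheckOfChi

open Literature.NumberTheory.GaloisRepresentations
open Literature.NumberTheory.Automorphic.UnitaryGroup
open Literature.NumberTheory.Automorphic.Liu2021.Def411WeilCarriers

/-! ## §1 `χ̌ᶜ = χ̌⁻¹` and `χ̌|_{𝕀_F} = 1` -/

section Generic

variable {F E : Type} [Field F] [Field E] [NumberField E] [Algebra F E] {c : E ≃ₐ[F] E}

/-- **`(c • x)_f = c • x_f`**: the finite part of a conjugated idèle is the conjugate of the finite part.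
[cite: CasselsFrohlichANT1967, Ch. VII §1.1] -/
theorem idelicFinPart_smul (x : ideleGroup E) :
    idelicFinPart E (c • x) = Units.map (conjFiniteAdele F E c).toMonoidHom (idelicFinPart E x) :=
  Units.ext (by rw [coe_idelicFinPart, AdeleRing.coe_smul_units, AdeleRing.smul_snd]; rfl)

/-- **`(c u)/(c u)ᶜ = (u/uᶜ)⁻¹`** in `U(1)(𝔸_{F,f})` (`c² = 1`). [cite: Liu2021, App. D §D.1 (l. 5224)] -/
theorem finAdelicCheck_unitsMap_conj (hcc : c * c = 1) (u : (FiniteAdeleRing (𝓞 E) E)ˣ) :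
    finAdelicCheck F E c hcc (Units.map (conjFiniteAdele F E c).toMonoidHom u) = (finAdelicCheck F E c hcc u)⁻¹ := by
  have hcU : Units.map (conjFiniteAdele F E c).toMonoidHom (Units.map (conjFiniteAdele F E c).toMonoidHom u) = u :=
    Units.ext (by
      change conjFiniteAdele F E c (conjFiniteAdele F E c (u : FiniteAdeleRing (𝓞 E) E)) = u
      rw [conjFiniteAdele_apply, conjFiniteAdele_apply, ← mul_smul, hcc, one_smul])
  refine Subtype.ext ?_
  rw [coe_finAdelicCheck, hcU, Subgroup.coe_inv, coe_finAdelicCheck, inv_div]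

/-- **`χ̌(c • x) = χ̌(x)⁻¹`** for every idèle `x` of `E`. [cite: Liu2021, App. D §D.1 (l. 5224); Lemma D.1 (4) (l. 5235)] -/
theorem checkOfChi_smul (hcc : c * c = 1) (χ : Chi F E c) (x : ideleGroup E) :
    HeckeCharacter.checkOfChi hcc χ (c • x) = (HeckeCharacter.checkOfChi hcc χ x)⁻¹ := by
  rw [checkOfChi_apply, checkOfChi_apply, idelicFinPart_smul, finAdelicCheck_unitsMap_conj, map_inv]

/-- **`χ̌ᶜ = χ̌⁻¹`**: the Galois conjugate of `χ̌` by `c` is its inverse (`HeckeCharacter.galConj`).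
[cite: Liu2021, App. D §D.1 (l. 5224); Lemma D.1 (4) (l. 5235)] -/
theorem galConj_checkOfChi (hcc : c * c = 1) (χ : Chi F E c) :
    HeckeCharacter.galConj c (HeckeCharacter.checkOfChi hcc χ) = (HeckeCharacter.checkOfChi hcc χ)⁻¹ := by
  ext x
  rw [HeckeCharacter.galConj_apply, checkOfChi_smul, HeckeCharacter.inv_apply]

/-- `χ̌` is trivial on the idèles fixed by `c`: `c • x = x ⇒ χ̌(x) = 1` (then `x_f/x_fᶜ = 1`).
[cite: Liu2021, App. D §D.1 (l. 5224)] -/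
theorem checkOfChi_eq_one_of_smul_eq (hcc : c * c = 1) (χ : Chi F E c) {x : ideleGroup E} (hx : c • x = x) :
    HeckeCharacter.checkOfChi hcc χ x = 1 := by
  have hf : Units.map (conjFiniteAdele F E c).toMonoidHom (idelicFinPart E x) = idelicFinPart E x := by
    rw [← idelicFinPart_smul, hx]
  have h1 : finAdelicCheck F E c hcc (idelicFinPart E x) = 1 :=
    Subtype.ext (by rw [coe_finAdelicCheck, hf, div_self', Subgroup.coe_one])
  rw [checkOfChi_apply, h1, map_one]

/-- **`χ̌|_{𝕀_F} = 1`**: `χ̌` is trivial on the idèles of the base field `F` (they are fixed by `c`, ★ `AdeleRing.smul_ideleBaseChange`)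
— the conjugate-ORTHOGONAL clause of [Liu2021, Def. 4.1] for `χ̌`. [cite: Liu2021, Def. 4.1 (l. 1900–1902); App. D §D.1 (l. 5224)] -/
theorem checkOfChi_ideleBaseChange [NumberField F] (hcc : c * c = 1) (χ : Chi F E c) (x : (AdeleRing (𝓞 F) F)ˣ) :
    HeckeCharacter.checkOfChi hcc χ (AdeleRing.ideleBaseChange F E x) = 1 :=
  checkOfChi_eq_one_of_smul_eq hcc χ (AdeleRing.smul_ideleBaseChange F E c x)

/-- **local form, no ramification hypothesis: `χ̌_{c • w}(c_* u) = χ̌_w(u)⁻¹`** (`c • ⟨u⟩_w = ⟨c_* u⟩_{c•w}`, ★ `algEquiv_smul_localUnits`).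
[cite: Liu2021, App. D §D.1 (l. 5224); Lemma D.1 (4) (l. 5235)] -/
theorem localComponent_checkOfChi_smul (hcc : c * c = 1) (χ : Chi F E c) (w : HeightOneSpectrum (𝓞 E))
    (u : (w.adicCompletion E)ˣ) :
    (HeckeCharacter.checkOfChi hcc χ).localComponent (c • w) (galAdicCompletionUnitsEquiv (L := E) c rfl u) =
      ((HeckeCharacter.checkOfChi hcc χ).localComponent w u)⁻¹ := by
  rw [HeckeCharacter.localComponent_apply, HeckeCharacter.localComponent_apply, ← algEquiv_smul_localUnits,
    checkOfChi_smul]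

/-- `χ̌` is unramified at `c • w` iff it is unramified at `w`. [cite: Liu2021, App. D §D.1 (l. 5224)] -/
theorem isUnramifiedAt_checkOfChi_smul_iff (hcc : c * c = 1) (χ : Chi F E c) (w : HeightOneSpectrum (𝓞 E)) :
    (HeckeCharacter.checkOfChi hcc χ).IsUnramifiedAt (c • w) ↔ (HeckeCharacter.checkOfChi hcc χ).IsUnramifiedAt w := by
  rw [← HeckeCharacter.isUnramifiedAt_galConj_iff c, galConj_checkOfChi]
  refine ⟨fun h => ?_, fun h => h.inv'⟩
  have := h.inv'
  rwa [inv_inv] at this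

/-- `χ̌⁻¹(ϖ_w) = χ̌(ϖ_w)⁻¹` (values at uniformisers of the inverse character). [cite: Liu2021, App. D §D.1 (l. 5224)] -/
theorem valueAtUniformizer_checkOfChi_inv (hcc : c * c = 1) (χ : Chi F E c) (w : HeightOneSpectrum (𝓞 E)) :
    (HeckeCharacter.checkOfChi hcc χ)⁻¹.valueAtUniformizer w = ((HeckeCharacter.checkOfChi hcc χ).valueAtUniformizer w)⁻¹ :=
  HeckeCharacter.valueAtUniformizer_inv' _ _

/-- **`χ̌(ϖ_{c • w}) = χ̌(ϖ_w)⁻¹`** off the conductor (`χ̌` unramified at `w`; the conjugate uniformiser is a uniformiser).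
[cite: Liu2021, App. D §D.1 (l. 5224); Lemma D.1 (4) (l. 5235)] -/
theorem valueAtUniformizer_checkOfChi_smul (hcc : c * c = 1) (χ : Chi F E c) {w : HeightOneSpectrum (𝓞 E)}
    (hw : (HeckeCharacter.checkOfChi hcc χ).IsUnramifiedAt w) :
    (HeckeCharacter.checkOfChi hcc χ).valueAtUniformizer (c • w) = ((HeckeCharacter.checkOfChi hcc χ).valueAtUniformizer w)⁻¹ := by
  have h := HeckeCharacter.valueAtUniformizer_galConj_of_isUnramifiedAt c (HeckeCharacter.checkOfChi hcc χ) w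
    ((isUnramifiedAt_checkOfChi_smul_iff hcc χ w).2 hw)
  rw [galConj_checkOfChi, valueAtUniformizer_checkOfChi_inv] at h
  exact h.symm

end Generic

/-! ## §2 The relabel `μ ↦ μ·χ̌` over a CM field keeps conjugate-symplecticity and the ∞-type -/

section CM

open Literature.NumberTheory.Automorphic.IdeleClassGroup

variable {L : Type} [Field L] [NumberField L] [IsCMField L]
variable (hcc : IsCMField.complexConj L * IsCMField.complexConj L = 1)
  (χ : Chi ↥(maximalRealSubfield L) L (IsCMField.complexConj L))
  {μ μ' : IdeleClassGroup L →ₜ* Circle}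
  (h : toHeckeCharacter L μ' = toHeckeCharacter L μ * HeckeCharacter.checkOfChi hcc χ)

include h in
/-- under the relabel `μ′ = μ·χ̌`: `μ′[x] · 1 = μ[x] · χ̌(x)` read in `ℂ`. [cite: Liu2021, Lemma D.1 (4) (l. 5235)] -/
theorem coe_apply_mk_eq_mul_of_toHeckeCharacter_eq (x : ideleGroup L) :
    ((μ' (x : IdeleClassGroup L) : ℂ)) = (μ (x : IdeleClassGroup L) : ℂ) * ((HeckeCharacter.checkOfChi hcc χ x : ℂˣ) : ℂ) := by
  rw [← coe_toHeckeCharacter_apply, ← coe_toHeckeCharacter_apply, h, HeckeCharacter.mul_apply, Units.val_mul]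

include h in
/-- **`μ′` and `μ` agree on the base classes** `classBaseChange L⁺ L` (`χ̌|_{𝕀_{L⁺}} = 1`). [cite: Liu2021, Def. 4.1 (l. 1900–1902); Lemma D.1 (4) (l. 5235)] -/
theorem apply_classBaseChange_eq_of_toHeckeCharacter_eq (a : IdeleClassGroup ↥(maximalRealSubfield L)) :
    μ' (classBaseChange (↥(maximalRealSubfield L)) L a) = μ (classBaseChange (↥(maximalRealSubfield L)) L a) := by
  obtain ⟨x, rfl⟩ := QuotientGroup.mk_surjective a
  refine Subtype.ext ?_
  have := coe_apply_mk_eq_mul_of_toHeckeCharacter_eq hcc χ h (AdeleRing.ideleBaseChange (↥(maximalRealSubfield L)) L x)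
  rwa [checkOfChi_ideleBaseChange, Units.val_one, mul_one] at this

include h in
/-- **`IsConjugateSymplectic L μ′ ↔ IsConjugateSymplectic L μ`** under `μ′ = μ·χ̌`. [cite: Liu2021, Def. 4.1 (l. 1900–1902); Lemma D.1 (4) (l. 5235)] -/
theorem isConjugateSymplectic_iff_of_toHeckeCharacter_eq : IsConjugateSymplectic L μ' ↔ IsConjugateSymplectic L μ := by
  refine forall_congr' fun a => ?_
  rw [apply_classBaseChange_eq_of_toHeckeCharacter_eq hcc χ h]

include h in
/-- `IsConjugateOrthogonal L μ′ ↔ IsConjugateOrthogonal L μ` under `μ′ = μ·χ̌`. [cite: Liu2021, Def. 4.1 (l. 1900–1902)] -/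
theorem isConjugateOrthogonal_iff_of_toHeckeCharacter_eq : IsConjugateOrthogonal L μ' ↔ IsConjugateOrthogonal L μ := by
  refine forall_congr' fun a => ?_
  rw [apply_classBaseChange_eq_of_toHeckeCharacter_eq hcc χ h]

include h in
/-- `μ′` and `μ` agree on the Galois norms `[y ȳ]` (`χ̌(y)·χ̌(ȳ) = 1`). [cite: Liu2021, Def. 4.1 (l. 1900–1902); Lemma D.1 (4) (l. 5235)] -/
theorem apply_classGalNorm_eq_of_toHeckeCharacter_eq (a : IdeleClassGroup L) :
    μ' (classGalNorm (↥(maximalRealSubfield L)) L a) = μ (classGalNorm (↥(maximalRealSubfield L)) L a) := by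
  obtain ⟨y, rfl⟩ := QuotientGroup.mk_surjective a
  refine Subtype.ext ?_
  have := coe_apply_mk_eq_mul_of_toHeckeCharacter_eq hcc χ h (AdeleRing.ideleGalNorm (↥(maximalRealSubfield L)) L y)
  rw [classGalNorm_mk]
  rwa [ideleGalNorm_eq_mul_complexConj_smul, map_mul, checkOfChi_smul, mul_inv_cancel, Units.val_one, mul_one,
    ← ideleGalNorm_eq_mul_complexConj_smul] at this

include h in
/-- `IsConjugateSelfDual L μ′ ↔ IsConjugateSelfDual L μ` under `μ′ = μ·χ̌`. [cite: Liu2021, Def. 4.1 (l. 1900–1902)] -/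
theorem isConjugateSelfDual_iff_of_toHeckeCharacter_eq : IsConjugateSelfDual L μ' ↔ IsConjugateSelfDual L μ := by
  refine forall_congr' fun a => ?_
  rw [apply_classGalNorm_eq_of_toHeckeCharacter_eq hcc χ h]

include h in
/-- `μ′` and `μ` agree on the classes of the infinite idèles (`χ̌_∞ = 1`). [cite: Liu2021, App. D §D.1 (l. 5224); Def. 4.3 (l. 1914–1921)] -/
theorem apply_infUnitsToClass_eq_of_toHeckeCharacter_eq (u : (InfiniteAdeleRing L)ˣ) :
    μ' (infUnitsToClass L u) = μ (infUnitsToClass L u) := by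
  refine Subtype.ext ?_
  have := coe_apply_mk_eq_mul_of_toHeckeCharacter_eq hcc χ h (infiniteIdeles L u)
  rwa [checkOfChi_infiniteIdeles, Units.val_one, mul_one] at this

include h in
/-- **`HasInfinityType L μ′ e ↔ HasInfinityType L μ e`** under `μ′ = μ·χ̌` (`χ̌` has ∞-type zero). [cite: Liu2021, Def. 4.3 (l. 1914–1921); App. D §D.1 (l. 5224)] -/
theorem hasInfinityType_iff_of_toHeckeCharacter_eq (e : InfinitePlace L → ℤ) :
    HasInfinityType L μ' e ↔ HasInfinityType L μ e := by
  refine forall_congr' fun u => ?_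
  rw [apply_infUnitsToClass_eq_of_toHeckeCharacter_eq hcc χ h]

include h in
/-- `HasWeight L μ′ 𝔴 ↔ HasWeight L μ 𝔴` under `μ′ = μ·χ̌`. [cite: Liu2021, Def. 4.3 (l. 1914–1921)] -/
theorem hasWeight_iff_of_toHeckeCharacter_eq (𝔴 : InfinitePlace L → ℕ) : HasWeight L μ' 𝔴 ↔ HasWeight L μ 𝔴 := by
  refine exists_congr fun e => ?_
  rw [hasInfinityType_iff_of_toHeckeCharacter_eq hcc χ h]

include h in
/-- `HasCMType L μ′ Φ ↔ HasCMType L μ Φ` under `μ′ = μ·χ̌`. [cite: Liu2021, Def. 4.3 (l. 1914–1921)] -/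
theorem hasCMType_iff_of_toHeckeCharacter_eq (Φ : Literature.AlgebraicGeometry.Motives.CMType L) :
    HasCMType L μ' Φ ↔ HasCMType L μ Φ := by
  refine exists_congr fun e => exists_congr fun he => ?_
  rw [hasInfinityType_iff_of_toHeckeCharacter_eq hcc χ h]

end CM

end Literature.NumberTheory.Automorphic.Liu2021.CheckOfChi

end
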